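/-
Copyright: the b2b-balaban T⁴-continuum CRUX team, row NE7b OWNER lineage `t4-ne7b-p1` (gen 127). Project licence.
-/
import Summits.QuantumFields.BalabanUV.T4Continuum.Spine.NE7b.SupFibreFiniteRangePieceBound

/-!
# THE SINGLE-SHELL SCALING OF THE FINITE-RANGE PIECES: for a symmetric matrix `A` with `λ₀·1 ≤ A ≤ 4·1`, `λ₀ > 0`, the `N`-th piece
# of the tree's dyadic Fejér decomposition satisfies `0 ≤ C_N(A) ≤ (π⁴∕(4·4^N·λ₀²))·1` (Loewner) — the spectral mapping theorem of the
# continuous functional calculus (`σ(q(A)) = q(σ(A))`, Mathlib) + the tree's symbol bound `F_{2^N−1}(x)² ≤ 1∕(16·4^N·x⁴)` at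
# `λ = 4sin²(πx)` + `x ≥ √λ∕(2π)`; hence for (273)'s data the field pieces of the fluctuation covariance have ENTRIES
# `|Γ_N(x,y)| ≤ c·q·π⁴∕(4·4^N·(c·m·p)²)` — geometric decay `4^{−N}` while the range grows like `2^N`: the sizes that (282)'s Dobrushin ∕
# Kotecký–Preiss thresholds consume (row NE7b, node U5c; (273)∕(283) + Mathlib's CFC + the tree's Fejér bounds BY NAME; [folklore])

Cell `pub-balaban`, sub-cell `t4`, spine estimate NE7b (`T4WeightBudget.RelWeightBound`; the cell's OWN estimate — NOT PRINTED in
[Bałaban 1983–89], NOT PROVED).  Crux-route work under `Spine/NE7b/` by the row OWNER (`t4-ne7b-p1` gen 127, file (284)) under FREEZE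
(0)'s crux-prover clause, on § [NE7bP1-G126-HANDOFF] NEXT (3)(d), at TEA's level; NOTHING of Bałaban's is named as a Lean object, valued or
asserted; no `T4Continuum/Support` leaf typed; no `def`, no notation; zero `sorry`.  Imports (BY NAME): the OWNER's (283)
`…SupFibreFiniteRangePieceBound` (`entry_le_of_form_le`, `form_eq_dotProduct`, `pushforward_symm`; through it (273) `pushforward_posSemidef`,
`pushforward_eq_mul`, `scaled_isHermitian`, `four_sub_scaled_posSemidef`, (271) `form_chart_eq`, `chart_apply`); the tree's
`Literature/Analysis/Fourier/FejerDyadicDecomposition` (`fejerPoly_eval_cos`, `fejer_sq_dyadic_le_inv`), `Literature/Analysis/Matrix/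
FiniteRangeDecomposition` (`frdPiece`, `frdCos`, `posSemidef_frdPiece`); Mathlib's `cfc_polynomial`, `cfc_map_spectrum`,
`Matrix.posSemidef_iff_isHermitian_and_spectrum_nonneg`, `spectrum.singleton_sub_eq`∕`sub_singleton_eq`, `Real.sin_arcsin`, `Real.sin_le`,
`Real.arcsin_le_pi_div_two`.

WHY (located).  (273)∕(278)∕(283) give the structure of the finite-range route and the a-priori bound `|Γ_N| ≤ m⁻¹`; the thresholds of the
scale-by-scale polymer gas ((282)) need the pieces to be SMALL at large `N` — the single-shell scaling.  On an eigenvector `Av = 4sin²(πx)v`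
the tree computed `C_Nv = ¼F_{2^N−1}(x)²v`; turning that into an operator inequality for a real symmetric `A` is the spectral mapping theorem,
which Mathlib's continuous functional calculus supplies for self-adjoint matrices (`C_N = q_N(A)` for an explicit polynomial `q_N`).  The floor
`λ₀` keeps `x ≥ √λ₀∕(2π)` away from the zero mode, so `¼F² ≤ π⁴∕(4·4^Nλ₀²)`.

WHAT IS PROVED ([folklore]; `V` finite, `A` real symmetric):
* §1 `spectrum_subset_Icc` (`λ₀·1 ≤ A ≤ 4·1` ⟹ `σ(A) ⊆ [λ₀, 4]`), `frdPiece_eq_aeval` (`C_N(A) = q_N(A)`,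
  `q_N = ¼(P_{2^N−1} ∘ (1 − X∕2))²`), `spectrum_frdPiece` (`σ(C_N(A)) = q_N(σ(A))`).
* §2 **`symbol_le`** (`λ ∈ [λ₀, 4]`, `λ₀ > 0` ⟹ `q_N(λ) ≤ π⁴∕(4·4^N·λ₀²)`).
* §3 **`frdPiece_le`** (THE LOEWNER BOUND `(π⁴∕(4·4^N·λ₀²))·1 − C_N(A) ≥ 0`), `frdPiece_form_le` (as a quadratic form).
* §4 `transpose_form_le` (`Σ_k(Σ_y(Pe_k)_yf_y)² ≤ q·Σf²` from the chart ceiling), THE END **`fibre_piece_entries_decay`**: for (273)'s data,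
  `|Γ_N(x,y)| ≤ c·q·π⁴∕(4·4^N·(c·m·p)²)` for all `x, y`, `c = 4∕(Λ_Hq)`; §5 toy.

HONEST (what this is NOT).  Chart `ℓ²` sizes by name (operator bound ⟹ entry bound); not the sharper `ℓ^∞`∕decay-weighted norms of a
BBS step, not summed over scales, nothing about the last-scale piece beyond (283); scalar skeleton ((A3), NC-NE7b-α UNRULED); nothing of
Bałaban's asserted.  BY-NAME EFFECT ON THE WALL: NONE.  NE7b NOT PRINTED ∕ NOT PROVED; spine PROVED 0∕9; rung (B)+1 — the programme's
measures remain FINITE-torus statements; NOT the mass gap, NOT Clay.  HONEST DEPENDENCY: continuum YM on T⁴ ⇐ BetaPertH ∧ nine spine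
estimates (0∕9 proved); BetaPertH ⇐ (D1) ∧ (D4) ∧ CAP+tail; G-an2-4 gates asym, D1 and NE2∕3∕4.
-/

set_option autoImplicit false

noncomputable section

namespace Summit.QuantumFields.BalabanUV.T4Continuum.NE7b.SupFrdPieceDecay

open Matrix Polynomial Real
open Literature.Analysis.Matrix (frdPiece frdCos posSemidef_frdPiece)
open Literature.Analysis.Fourier.TrigApprox (fejerPoly fejer fejerPoly_eval_cos fejer_sq_dyadic_le_inv fejer_nonneg)
open SupFibreGaussianCovariance (form_chart_eq chart_apply chart_posDef)
open SupFibreFiniteRangeDecomposition (pushforward_posSemidef scaled_isHermitian four_sub_scaled_posSemidef)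
open SupFibreFiniteRangePieceBound (entry_le_of_form_le form_eq_dotProduct pushforward_symm)

/-! ## §1. Spectrum of `A` and of the pieces -/

section Generic

variable {V : Type*} [Fintype V] [DecidableEq V]

/-- **`λ₀·1 ≤ A ≤ 4·1` ⟹ `σ(A) ⊆ [λ₀, 4]`** (real symmetric `A`). [folklore] -/
theorem spectrum_subset_Icc (A : Matrix V V ℝ) {lam0 : ℝ} (hlo : (A - lam0 • (1 : Matrix V V ℝ)).PosSemidef)
    (hhi : ((4 : ℝ) • (1 : Matrix V V ℝ) - A).PosSemidef) : spectrum ℝ A ⊆ Set.Icc lam0 4 := by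
  intro μ hμ
  have h1 := (Matrix.posSemidef_iff_isHermitian_and_spectrum_nonneg.1 hlo).2
  have h2 := (Matrix.posSemidef_iff_isHermitian_and_spectrum_nonneg.1 hhi).2
  have e1 : A - lam0 • (1 : Matrix V V ℝ) = A - algebraMap ℝ (Matrix V V ℝ) lam0 := by rw [Algebra.algebraMap_eq_smul_one]
  have e2 : (4 : ℝ) • (1 : Matrix V V ℝ) - A = algebraMap ℝ (Matrix V V ℝ) 4 - A := by rw [Algebra.algebraMap_eq_smul_one]
  have hμ1 : μ - lam0 ∈ spectrum ℝ (A - lam0 • (1 : Matrix V V ℝ)) := by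
    rw [e1, ← spectrum.sub_singleton_eq]; exact Set.sub_mem_sub hμ (Set.mem_singleton _)
  have hμ2 : 4 - μ ∈ spectrum ℝ ((4 : ℝ) • (1 : Matrix V V ℝ) - A) := by
    rw [e2, ← spectrum.singleton_sub_eq]; exact Set.sub_mem_sub (Set.mem_singleton _) hμ
  have h1' := h1 hμ1
  have h2' := h2 hμ2
  simp only [Set.mem_setOf_eq] at h1' h2'
  constructor <;> linarith

/-- **THE PIECE IS A POLYNOMIAL IN `A`**: `C_N(A) = q_N(A)` with `q_N = ¼(P_{2^N−1} ∘ (1 − X∕2))²`. [folklore] -/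
theorem frdPiece_eq_aeval (A : Matrix V V ℝ) (N : ℕ) :
    frdPiece A N = aeval A (C (1 / 4 : ℝ) * ((fejerPoly (2 ^ N - 1)).comp (C 1 - C (1 / 2 : ℝ) * X)) ^ 2) := by
  unfold frdPiece frdCos
  simp only [map_mul, map_pow, aeval_C, aeval_comp, map_sub, aeval_X, Algebra.algebraMap_eq_smul_one, smul_mul_assoc,
    one_mul, one_smul]

/-- **SPECTRAL MAPPING FOR THE PIECE**: `σ(C_N(A)) = q_N(σ(A))` for symmetric `A` (Mathlib's continuous functional calculus). [folklore] -/
theorem spectrum_frdPiece (A : Matrix V V ℝ) (hA : A.IsHermitian) (N : ℕ) :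
    spectrum ℝ (frdPiece A N)
      = (fun x => (C (1 / 4 : ℝ) * ((fejerPoly (2 ^ N - 1)).comp (C 1 - C (1 / 2 : ℝ) * X)) ^ 2).eval x) '' spectrum ℝ A := by
  rw [frdPiece_eq_aeval, ← cfc_polynomial _ A hA.isSelfAdjoint, cfc_map_spectrum _ A hA.isSelfAdjoint]

/-! ## §2. The symbol bound -/

/-- **THE SYMBOL BOUND**: `0 < λ₀ ≤ λ ≤ 4` ⟹ `q_N(λ) = ¼F_{2^N−1}(x)² ≤ π⁴∕(4·4^N·λ₀²)` (`λ = 4sin²(πx)`, `√λ₀∕(2π) ≤ x ≤ ½`). [folklore] -/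
theorem symbol_le (N : ℕ) {lam0 lam : ℝ} (hlam0 : 0 < lam0) (hlo : lam0 ≤ lam) (hhi : lam ≤ 4) :
    (C (1 / 4 : ℝ) * ((fejerPoly (2 ^ N - 1)).comp (C 1 - C (1 / 2 : ℝ) * X)) ^ 2).eval lam
      ≤ π ^ 4 / (4 * 4 ^ N * lam0 ^ 2) := by
  have hlam : 0 < lam := hlam0.trans_le hlo
  -- the angle `x` with `λ = 4 sin²(πx)`
  obtain ⟨x, hx⟩ : ∃ x : ℝ, x = arcsin (sqrt lam / 2) / π := ⟨_, rfl⟩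
  have hs2 : sqrt lam ≤ 2 := by
    rw [show (2 : ℝ) = sqrt 4 by rw [show (4 : ℝ) = 2 ^ 2 by norm_num, sqrt_sq (by norm_num)]]
    exact sqrt_le_sqrt hhi
  have hspos : 0 < sqrt lam := sqrt_pos.2 hlam
  have hsin : sin (π * x) = sqrt lam / 2 := by
    rw [hx, mul_div_cancel₀ _ pi_ne_zero]
    exact sin_arcsin (by linarith) (by linarith)
  have hxpos : 0 < x := by rw [hx]; exact div_pos (arcsin_pos.2 (by linarith)) pi_pos
  have hxle : |x| ≤ 1 / 2 := by
    rw [abs_of_pos hxpos, hx, div_le_iff₀ pi_pos]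
    have := arcsin_le_pi_div_two (sqrt lam / 2)
    linarith
  -- `cos(2πx) = 1 − λ/2`, so the polynomial evaluates to `¼F(x)²`
  have hcos : cos (2 * π * x) = 1 - lam / 2 := by
    rw [show 2 * π * x = 2 * (π * x) by ring, cos_two_mul, cos_sq', hsin]
    have : sqrt lam ^ 2 = lam := sq_sqrt hlam.le
    nlinarith
  have heval : (C (1 / 4 : ℝ) * ((fejerPoly (2 ^ N - 1)).comp (C 1 - C (1 / 2 : ℝ) * X)) ^ 2).eval lam
      = 1 / 4 * fejer (2 ^ N - 1) x ^ 2 := by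
    simp only [eval_mul, eval_C, eval_pow, eval_comp, eval_sub, eval_X]
    rw [show (1 : ℝ) - 1 / 2 * lam = cos (2 * π * x) by rw [hcos]; ring, fejerPoly_eval_cos]
  rw [heval]
  -- `x ≥ √λ∕(2π) ≥ √λ₀∕(2π)`: `sin(πx) ≤ πx`
  have hxlow : sqrt lam / 2 ≤ π * x := by rw [← hsin]; exact sin_le (by positivity)
  have hF := fejer_sq_dyadic_le_inv N hxpos.ne' hxle
  have hx4 : lam0 ^ 2 / (16 * π ^ 4) ≤ x ^ 4 := by
    have h1 : sqrt lam0 ≤ sqrt lam := sqrt_le_sqrt hlo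
    have h2 : sqrt lam0 / (2 * π) ≤ x := by
      rw [div_le_iff₀ (by positivity)]; nlinarith
    have h3 : 0 ≤ sqrt lam0 / (2 * π) := by positivity
    have h4 := pow_le_pow_left₀ h3 h2 4
    have h5 : (sqrt lam0 / (2 * π)) ^ 4 = lam0 ^ 2 / (16 * π ^ 4) := by
      rw [div_pow, show sqrt lam0 ^ 4 = (sqrt lam0 ^ 2) ^ 2 by ring, sq_sqrt hlam0.le]; ring
    linarith
  have hx4pos : 0 < x ^ 4 := by positivity
  calc 1 / 4 * fejer (2 ^ N - 1) x ^ 2 ≤ 1 / 4 * (1 / (16 * 4 ^ N * x ^ 4)) := by gcongr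
    _ ≤ 1 / 4 * (1 / (16 * 4 ^ N * (lam0 ^ 2 / (16 * π ^ 4)))) := by gcongr
    _ = π ^ 4 / (4 * 4 ^ N * lam0 ^ 2) := by field_simp

/-! ## §3. The Loewner bound on the pieces -/

/-- **THE SINGLE-SHELL SCALING, LOEWNER FORM**: `A` real symmetric with `λ₀·1 ≤ A ≤ 4·1`, `λ₀ > 0` ⟹ for every `N`,
`(π⁴∕(4·4^N·λ₀²))·1 − C_N(A)` is positive semidefinite (and `C_N(A) ≥ 0` is the tree's). [folklore] -/
theorem frdPiece_le (A : Matrix V V ℝ) (hA : A.IsHermitian) {lam0 : ℝ} (hlam0 : 0 < lam0)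
    (hlo : (A - lam0 • (1 : Matrix V V ℝ)).PosSemidef) (hhi : ((4 : ℝ) • (1 : Matrix V V ℝ) - A).PosSemidef) (N : ℕ) :
    ((π ^ 4 / (4 * 4 ^ N * lam0 ^ 2)) • (1 : Matrix V V ℝ) - frdPiece A N).PosSemidef := by
  rw [Matrix.posSemidef_iff_isHermitian_and_spectrum_nonneg]
  refine ⟨(Matrix.isHermitian_one.smul (IsSelfAdjoint.all _)).sub (posSemidef_frdPiece hA N).isHermitian, fun μ hμ => ?_⟩
  have hK : (π ^ 4 / (4 * 4 ^ N * lam0 ^ 2)) • (1 : Matrix V V ℝ) - frdPiece A N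
      = algebraMap ℝ (Matrix V V ℝ) (π ^ 4 / (4 * 4 ^ N * lam0 ^ 2)) - frdPiece A N := by
    rw [Algebra.algebraMap_eq_smul_one]
  rw [hK, ← spectrum.singleton_sub_eq, spectrum_frdPiece A hA N] at hμ
  obtain ⟨k, hk, ν, ⟨lam, hlam, rfl⟩, rfl⟩ := hμ
  rw [Set.mem_singleton_iff] at hk
  subst hk
  obtain ⟨hlo', hhi'⟩ := spectrum_subset_Icc A hlo hhi hlam
  have h := symbol_le N hlam0 hlo' hhi'
  simp only [Set.mem_setOf_eq, sub_nonneg]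
  exact h

/-- The same as a quadratic form: `0 ≤ gᵀC_N(A)g ≤ (π⁴∕(4·4^N·λ₀²))·Σg²`. [folklore] -/
theorem frdPiece_form_le (A : Matrix V V ℝ) (hA : A.IsHermitian) {lam0 : ℝ} (hlam0 : 0 < lam0)
    (hlo : (A - lam0 • (1 : Matrix V V ℝ)).PosSemidef) (hhi : ((4 : ℝ) • (1 : Matrix V V ℝ) - A).PosSemidef) (N : ℕ) (g : V → ℝ) :
    0 ≤ g ⬝ᵥ frdPiece A N *ᵥ g ∧ g ⬝ᵥ frdPiece A N *ᵥ g ≤ π ^ 4 / (4 * 4 ^ N * lam0 ^ 2) * ∑ k, g k ^ 2 := by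
  have h0 := (posSemidef_frdPiece hA N).dotProduct_mulVec_nonneg g
  have h1 := (frdPiece_le A hA hlam0 hlo hhi N).dotProduct_mulVec_nonneg g
  rw [star_trivial] at h0 h1
  rw [sub_mulVec, dotProduct_sub, smul_mulVec, one_mulVec, dotProduct_smul, smul_eq_mul, sub_nonneg] at h1
  have hgg : g ⬝ᵥ g = ∑ k, g k ^ 2 := Finset.sum_congr rfl fun k _ => by ring
  rw [hgg] at h1
  exact ⟨h0, h1⟩

end Generic

/-! ## §4. THE END: the field pieces of the fluctuation covariance decay like `4^{−N}` -/

section Fibre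

variable {ι : Type*} [Fintype ι] {σ : Type} [Fintype σ] [DecidableEq σ]
  {H : (ι → ℝ) →L[ℝ] (ι → ℝ) →L[ℝ] ℝ} {m p ΛH q : ℝ} (P : (σ → ℝ) →L[ℝ] (ι → ℝ))

omit [Fintype ι] in
/-- **THE TRANSPOSED CHART IS BOUNDED BY THE CHART CEILING**: `Σ(Pz)² ≤ qΣz²` ⟹ `Σ_k(Σ_y(Pe_k)_yf_y)² ≤ q·Σ_yf_y²`. [folklore] -/
theorem transpose_form_le [Fintype ι] (hPceil : ∀ z : σ → ℝ, ∑ x, P z x ^ 2 ≤ q * ∑ i, z i ^ 2) (hq : 0 ≤ q) (f : ι → ℝ) :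
    ∑ k, (∑ y, P (Pi.single k 1) y * f y) ^ 2 ≤ q * ∑ y, f y ^ 2 := by
  -- with `g = Pᵀf`: `Σg² = Σ_y f_y (Pg)_y ≤ ‖f‖·‖Pg‖ ≤ ‖f‖·√q·‖g‖`
  obtain ⟨g, hg⟩ : ∃ g : σ → ℝ, g = fun k => ∑ y, P (Pi.single k 1) y * f y := ⟨_, rfl⟩
  have hG : ∑ k, (∑ y, P (Pi.single k 1) y * f y) ^ 2 = ∑ y, f y * P g y := by
    rw [show (∑ y, f y * P g y) = ∑ y, f y * ∑ k, g k * P (Pi.single k 1) y from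
      Finset.sum_congr rfl fun y _ => by rw [chart_apply P g y]]
    rw [hg]
    simp only [Finset.mul_sum]
    rw [Finset.sum_comm]
    refine Finset.sum_congr rfl fun k _ => ?_
    rw [sq, Finset.mul_sum]
    exact Finset.sum_congr rfl fun y _ => by ring
  rw [hG]
  have hcs1 : (∑ y, f y * P g y) ^ 2 ≤ (∑ y, f y ^ 2) * ∑ y, P g y ^ 2 := Finset.sum_mul_sq_le_sq_mul_sq Finset.univ f (P g)
  have hP := hPceil g
  have hgg : ∑ i, g i ^ 2 = ∑ y, f y * P g y := by rw [← hG, hg]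
  have hF : 0 ≤ ∑ y, f y ^ 2 := Finset.sum_nonneg fun y _ => sq_nonneg _
  have hS : 0 ≤ ∑ y, f y * P g y := by rw [← hgg]; exact Finset.sum_nonneg fun i _ => sq_nonneg _
  -- `S² ≤ F·(PgPg) ≤ F·q·S`, hence `S ≤ qF`
  have key : (∑ y, f y * P g y) * (∑ y, f y * P g y) ≤ (q * ∑ y, f y ^ 2) * ∑ y, f y * P g y := by
    calc (∑ y, f y * P g y) * (∑ y, f y * P g y) = (∑ y, f y * P g y) ^ 2 := by ring
      _ ≤ (∑ y, f y ^ 2) * ∑ y, P g y ^ 2 := hcs1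
      _ ≤ (∑ y, f y ^ 2) * (q * ∑ i, g i ^ 2) := mul_le_mul_of_nonneg_left hP hF
      _ = (q * ∑ y, f y ^ 2) * ∑ y, f y * P g y := by rw [hgg]; ring
  rcases hS.eq_or_lt with h0 | hpos
  · rw [← h0]; positivity
  · exact le_of_mul_le_mul_right key hpos

/-- **HEADLINE — THE FIELD PIECES DECAY LIKE `4^{−N}`.**  For (273)'s data (`H` symmetric with floor `m > 0` and ceiling `Λ_H > 0`, chart
bound `p > 0` and ceiling `q > 0`, `M_z(j,k) = H(Pe_j)(Pe_k)`, `c = 4∕(Λ_Hq)`, `A = cM_z`, so `(cmp)·1 ≤ A ≤ 4·1`): for every `N` and all field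
sites `x, y`, `|Γ_N(x,y)| ≤ c·q·π⁴∕(4·4^N·(cmp)²)` where `Γ_N = Γ(c·C_N(A))` is (273)'s `N`-th piece of the fluctuation covariance.
[folklore] -/
theorem fibre_piece_entries_decay (hHsym : ∀ h k : ι → ℝ, H h k = H k h) (hfl : ∀ h : ι → ℝ, m * ∑ x, h x ^ 2 ≤ H h h)
    (hm : 0 < m) (hceil : ∀ h : ι → ℝ, H h h ≤ ΛH * ∑ x, h x ^ 2) (hΛH : 0 < ΛH)
    (hP : ∀ z : σ → ℝ, p * ∑ i, z i ^ 2 ≤ ∑ x, P z x ^ 2) (hp : 0 < p) (hPceil : ∀ z : σ → ℝ, ∑ x, P z x ^ 2 ≤ q * ∑ i, z i ^ 2)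
    (hq : 0 < q) (Mz : Matrix σ σ ℝ) (hMz : ∀ j k, Mz j k = H (P (Pi.single j 1)) (P (Pi.single k 1))) (N : ℕ) (x y : ι) :
    |∑ j, ∑ k, P (Pi.single j 1) x * ((4 / (ΛH * q)) • frdPiece ((4 / (ΛH * q)) • Mz) N) j k * P (Pi.single k 1) y|
      ≤ (4 / (ΛH * q)) * q * (π ^ 4 / (4 * 4 ^ N * ((4 / (ΛH * q)) * m * p) ^ 2)) := by
  have hc : (0 : ℝ) < 4 / (ΛH * q) := by positivity
  have hAH := scaled_isHermitian P hHsym Mz hMz (4 / (ΛH * q))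
  have hlam0 : 0 < (4 / (ΛH * q)) * m * p := by positivity
  -- `(cmp)·1 ≤ A`
  have hlo : ((4 / (ΛH * q)) • Mz - ((4 / (ΛH * q)) * m * p) • (1 : Matrix σ σ ℝ)).PosSemidef := by
    refine Matrix.PosSemidef.of_dotProduct_mulVec_nonneg (hAH.sub (Matrix.isHermitian_one.smul (IsSelfAdjoint.all _))) fun z => ?_
    rw [star_trivial, sub_mulVec, dotProduct_sub, smul_mulVec, smul_mulVec, one_mulVec, dotProduct_smul, dotProduct_smul, smul_eq_mul,
      smul_eq_mul, ← form_chart_eq P Mz hMz, sub_nonneg]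
    have hzz : z ⬝ᵥ z = ∑ i, z i ^ 2 := Finset.sum_congr rfl fun i _ => by ring
    rw [hzz]
    have h1 := hfl (P z)
    have h2 := hP z
    nlinarith [mul_le_mul_of_nonneg_left h2 hm.le, hc.le, mul_nonneg hc.le (le_trans (by positivity) (le_trans (mul_le_mul_of_nonneg_left h2 hm.le) h1))]
  have hhi := four_sub_scaled_posSemidef P hHsym hceil hΛH hPceil hq Mz hMz
  -- the form bound of the field piece: `fᵀΓ_Nf = c·gᵀC_Ng ≤ c·K·Σg² ≤ c·K·q·Σf²`
  have hD : ((4 / (ΛH * q)) • frdPiece ((4 / (ΛH * q)) • Mz) N).PosSemidef := (posSemidef_frdPiece hAH N).smul hc.le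
  have hDT : ((4 / (ΛH * q)) • frdPiece ((4 / (ΛH * q)) • Mz) N)ᵀ = (4 / (ΛH * q)) • frdPiece ((4 / (ΛH * q)) • Mz) N := by
    have h := hD.isHermitian
    rwa [IsHermitian, conjTranspose_eq_transpose_of_trivial] at h
  refine entry_le_of_form_le _ (pushforward_symm P hDT) (fun f => ?_) (fun f => ?_) x y
  · rw [form_eq_dotProduct]
    have h := (pushforward_posSemidef P hD).dotProduct_mulVec_nonneg f
    rwa [star_trivial] at h
  · -- `fᵀΓ(D)f = gᵀDg` with `g = P_mᵀf`
    rw [form_eq_dotProduct, SupFibreFiniteRangeDecomposition.pushforward_eq_mul P, ← mulVec_mulVec, ← mulVec_mulVec, dotProduct_mulVec,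
      ← mulVec_transpose]
    have hg : (Matrix.of fun x j => P (Pi.single j 1) x)ᵀ *ᵥ f = fun k => ∑ y, P (Pi.single k 1) y * f y := by
      funext k
      simp only [mulVec, dotProduct, transpose_apply, of_apply]
    rw [hg, smul_mulVec, dotProduct_smul, smul_eq_mul]
    have hform := (frdPiece_form_le ((4 / (ΛH * q)) • Mz) hAH hlam0 hlo hhi N (fun k => ∑ y, P (Pi.single k 1) y * f y)).2
    have hT := transpose_form_le P hPceil hq.le f
    have hK : 0 ≤ π ^ 4 / (4 * 4 ^ N * ((4 / (ΛH * q)) * m * p) ^ 2) := by positivity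
    calc (4 / (ΛH * q)) * ((fun k => ∑ y, P (Pi.single k 1) y * f y) ⬝ᵥ frdPiece ((4 / (ΛH * q)) • Mz) N
          *ᵥ fun k => ∑ y, P (Pi.single k 1) y * f y)
        ≤ (4 / (ΛH * q)) * (π ^ 4 / (4 * 4 ^ N * ((4 / (ΛH * q)) * m * p) ^ 2) * ∑ k, (∑ y, P (Pi.single k 1) y * f y) ^ 2) :=
          mul_le_mul_of_nonneg_left hform hc.le
      _ ≤ (4 / (ΛH * q)) * (π ^ 4 / (4 * 4 ^ N * ((4 / (ΛH * q)) * m * p) ^ 2) * (q * ∑ y, f y ^ 2)) :=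
          mul_le_mul_of_nonneg_left (mul_le_mul_of_nonneg_left hT hK) hc.le
      _ = (4 / (ΛH * q)) * q * (π ^ 4 / (4 * 4 ^ N * ((4 / (ΛH * q)) * m * p) ^ 2)) * ∑ y, f y ^ 2 := by ring

end Fibre

/-! ## §5. Toy -/

/-- Toy: the symbol bound at the top of the spectrum (`λ₀ = λ = 4`, `N = 0`): `q_0(4) ≤ π⁴∕64`. -/
example : (C (1 / 4 : ℝ) * ((fejerPoly (2 ^ 0 - 1)).comp (C 1 - C (1 / 2 : ℝ) * X)) ^ 2).eval 4 ≤ π ^ 4 / (4 * 4 ^ 0 * 4 ^ 2) :=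
  symbol_le 0 (by norm_num) le_rfl le_rfl

end Summit.QuantumFields.BalabanUV.T4Continuum.NE7b.SupFrdPieceDecay
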